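import Mathlib.Data.Nat.Choose.Basic
import Mathlib.Order.Interval.Finset.Fin
import Mathlib.Order.UpperLower.Basic
import Mathlib.Algebra.Order.BigOperators.Group.Finset
import Mathlib.Tactic.Positivity
import Mathlib.Tactic.Linarith
import Mathlib.Tactic.Ring
import Mathlib.Tactic.GCongr
import HarnessLib

/-!
# The binomial optimisation in Landsberg–Michałek 2018, Thm. 1.1: `Σ_{(i,j) ∈ λ} g(i,j) ≤ C(n−1+m, m−1)`

Topic `Literature/Computability/AlgebraicComplexity`. Pure binomial-coefficient inequalities (all
PROVED, no definitions) forming the last step of Part 2 of the proof of Landsberg–Michałek 2018,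
Thm. 1.1 (`LandsbergMichalekKoszul.lean`, `BorderRankMatMulSmallProofs.lean`). With `n = p + 1` and
`0`-indexed cells `(x, y)` of a Young diagram `λ` (a lower set of `Fin (p+1) × Fin (p+1)` for the
product order, corner `(0,0)`), the number of diagonal entries of the reduced Koszul flattening killed
by deleting the cell `(x, y)` is
`g(x, y) = C(p − x + y, y) · C(p + x − y, x)` (LM18 §3: `g(i,j) = C(n−i+j−1, j−1) C(n+i−j−1, i−1)`,
`i = x + 1`, `j = y + 1`), and LM18 need `f_λ = Σ_{λ} g ≤ C(n − 1 + m, m − 1)` for `|λ| = m < n`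
("the Young diagram that maximizes `f_λ` has one row or column").

* `choose_mul_choose_le_choose` — the cell inequality LM18 (2), `g(i,j) ≤ g(1, ij)` for `n ≥ ij`,
  in the subtraction-free form `C(2b+c, b) C(2a+c, a) ≤ C(ab+2a+2b+c, ab+a+b)` (`ab ≤ c`). LM18
  prove it by induction on `n` through the ratio inequality (3), checking `j = 2, 3` and `i = 2` by
  hand (the ratio step (3) is false at `i = j = 2`, `n = 4`); here it is proved uniformly by induction
  on `a` using `C(N+S+e, S+e) T^e ≥ C(N+S, S) (N+T)^e` (`choose_mul_pow_le`) and the second-order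
  binomial bound `(N+T)^{b+1} ≥ T^{b+1} + (b+1) N T^b + C(b+1,2) N² T^{b−1}` (`two_mul_add_pow_ge`,
  `key_pow_ineq`).
* `sum_lmCell_choose_le` — `Σ_{(x,y) ∈ λ} g(x,y) ≤ C(p + m + 1, m)` for lower sets with `m + 1 ≤ p`
  cells: remove a maximal cell `(x,y)` (so `(x+1)(y+1) ≤ |λ|`, `mul_le_card_of_isLowerSet`), bound
  `g(x,y) ≤ C(p+k, k)`, `k = xy+x+y`, use monotonicity of `k ↦ C(p+k,k)` and Pascal's rule.

## References

* J. M. Landsberg, M. Michałek, *A `2n² − log₂(n) − 1` lower bound for the border rank of matrix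
  multiplication*, IMRN 2018 (15) 4722–4733 = arXiv:1608.07486 (held: paper:arxiv-1608.07486,
  chunk 6): §3, the function `g(i,j)`, inequalities (2)–(3). [LandsbergMichalek2018]
-/

open scoped BigOperators

namespace Literature.Computability.AlgebraicComplexity

/-! ## The binomial optimisation: `Σ_{(x,y) ∈ λ} g(x,y) ≤ C(p+m, m−1)` for Young diagrams -/

section Binomial

/-- Second-order binomial lower bound: `2(T+N)^{e+2} ≥ 2T^{e+2} + 2(e+2) N T^{e+1} + (e+2)(e+1) N² T^e`.
[folklore] -/
theorem two_mul_add_pow_ge (T N e : ℕ) :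
    2 * T ^ (e + 2) + 2 * (e + 2) * N * T ^ (e + 1) + (e + 2) * (e + 1) * N ^ 2 * T ^ e ≤
      2 * (T + N) ^ (e + 2) := by
  induction e with
  | zero => apply le_of_eq; ring
  | succ e ih =>
    have h1 : 2 * (T + N) ^ (e + 1 + 2) = (T + N) * (2 * (T + N) ^ (e + 2)) := by ring
    rw [h1]
    have h2 := Nat.mul_le_mul_left (T + N) ih
    refine le_trans ?_ h2
    have : 2 * T ^ (e + 1 + 2) + 2 * (e + 1 + 2) * N * T ^ (e + 1 + 1) +
        (e + 1 + 2) * (e + 1 + 1) * N ^ 2 * T ^ (e + 1) +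
        ((e + 2) * (e + 1) * N ^ 3 * T ^ e) =
      (T + N) * (2 * T ^ (e + 2) + 2 * (e + 2) * N * T ^ (e + 1) + (e + 2) * (e + 1) * N ^ 2 * T ^ e) := by
      ring
    omega

/-- The numerical heart of the cell inequality: for `a, b ≥ 1`, `T = ab + a + b ≤ N`,
`(N + a) T^{b+1} ≤ a (N + T)^{b+1}` (from the second-order binomial bound and
`a (b+1)(b+2) ≥ 2T`). [cite: LandsbergMichalek2018, §3 (proof of inequality (2))] -/
theorem key_pow_ineq (a b N : ℕ) (ha : 1 ≤ a) (hb : 1 ≤ b) (hN : a * b + a + b ≤ N) :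
    (N + a) * (a * b + a + b) ^ (b + 1) ≤ a * (N + (a * b + a + b)) ^ (b + 1) := by
  obtain ⟨e, rfl⟩ : ∃ e, b = e + 1 := ⟨b - 1, by omega⟩
  set T := a * (e + 1) + a + (e + 1) with hT
  have hbin := two_mul_add_pow_ge T N e
  -- `N² T^e ≥ N T^{e+1}` as `N ≥ T`
  have h1 : N * T ^ (e + 1) ≤ N ^ 2 * T ^ e := by
    rw [pow_succ, sq]
    calc N * (T ^ e * T) = T * (N * T ^ e) := by ring
      _ ≤ N * (N * T ^ e) := Nat.mul_le_mul_right _ hN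
      _ = N * N * T ^ e := by ring
  -- `a (e+2)(e+3) ≥ 2T`
  have h2 : 2 * T ≤ a * ((e + 2) * (e + 3)) := by
    have := Nat.mul_le_mul_right ((e + 2) * (e + 1)) ha
    rw [hT]; nlinarith [this]
  -- assemble: `2a(T+N)^{e+2} ≥ a[2T^{e+2} + 2(e+2)NT^{e+1} + (e+2)(e+1)N T^{e+1}] ≥ 2(N+a)T^{e+2}`
  have h3 : 2 * ((N + a) * T ^ (e + 1 + 1)) ≤ 2 * (a * (N + T) ^ (e + 1 + 1)) := by
    have e1 : 2 * (a * (N + T) ^ (e + 1 + 1)) = a * (2 * (T + N) ^ (e + 2)) := by ring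
    rw [e1]
    refine le_trans ?_ (Nat.mul_le_mul_left a hbin)
    have h4 : a * (2 * T ^ (e + 2) + 2 * (e + 2) * N * T ^ (e + 1) + (e + 2) * (e + 1) * N ^ 2 * T ^ e) ≥
        a * (2 * T ^ (e + 2) + 2 * (e + 2) * N * T ^ (e + 1) + (e + 2) * (e + 1) * (N * T ^ (e + 1))) := by
      apply Nat.mul_le_mul_left
      have := Nat.mul_le_mul_left ((e + 2) * (e + 1)) h1
      nlinarith
    refine le_trans ?_ h4
    have e2 : a * (2 * T ^ (e + 2) + 2 * (e + 2) * N * T ^ (e + 1) + (e + 2) * (e + 1) * (N * T ^ (e + 1))) =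
        2 * a * T ^ (e + 2) + (a * ((e + 2) * (e + 3))) * (N * T ^ (e + 1)) := by ring
    rw [e2]
    have h5 : 2 * T * (N * T ^ (e + 1)) ≤ (a * ((e + 2) * (e + 3))) * (N * T ^ (e + 1)) :=
      Nat.mul_le_mul_right _ h2
    have e3 : 2 * ((N + a) * T ^ (e + 1 + 1)) = 2 * a * T ^ (e + 2) + 2 * T * (N * T ^ (e + 1)) := by ring
    rw [e3]
    omega
  omega

/-- Ratio form of `C(N+S+e, S+e) / C(N+S, S) = ∏_{t=S+1}^{S+e} (N+t)/t ≥ ((N+T)/T)^e` for `S + e ≤ T`: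
`C(N+S, S) (N+T)^e ≤ C(N+S+e, S+e) T^e`. [folklore] -/
theorem choose_mul_pow_le (N S T e : ℕ) (he : S + e ≤ T) :
    (N + S).choose S * (N + T) ^ e ≤ (N + S + e).choose (S + e) * T ^ e := by
  induction e with
  | zero => simp
  | succ e ih =>
    have ih' := ih (by omega)
    have hid : (N + S + e + 1) * (N + S + e).choose (S + e) =
        (N + S + e + 1).choose (S + e + 1) * (S + e + 1) := Nat.add_one_mul_choose_eq _ _
    have hpos : 0 < S + e + 1 := Nat.succ_pos _
    refine Nat.le_of_mul_le_mul_right ?_ hpos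
    have ht : (N + T) * (S + e + 1) ≤ (N + S + e + 1) * T := by nlinarith
    calc (N + S).choose S * (N + T) ^ (e + 1) * (S + e + 1)
        = ((N + S).choose S * (N + T) ^ e) * ((N + T) * (S + e + 1)) := by ring
      _ ≤ ((N + S + e).choose (S + e) * T ^ e) * ((N + S + e + 1) * T) :=
          Nat.mul_le_mul ih' ht
      _ = ((N + S + e + 1) * (N + S + e).choose (S + e)) * T ^ (e + 1) := by ring
      _ = (N + S + e + 1).choose (S + e + 1) * (S + e + 1) * T ^ (e + 1) := by rw [hid]
      _ = (N + S + (e + 1)).choose (S + (e + 1)) * T ^ (e + 1) * (S + e + 1) := by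
          rw [show N + S + (e + 1) = N + S + e + 1 by ring, show S + (e + 1) = S + e + 1 by ring]
          ring

/-- **The cell inequality** (LM18 §3, inequality (2): `g(i,j) ≤ g(1, ij)` for `n ≥ ij`), in the
subtraction-free form `C(2b+c, b) C(2a+c, a) ≤ C(ab+2a+2b+c, ab+a+b)` for `ab ≤ c`
(`N = a+b+c ≥ T = ab+a+b`, `N−a+b = 2b+c`, `N+a−b = 2a+c`). Proved by induction on `a`
(LM18 induct on `n`; their ratio step fails at `i = j = 2`, which they check by hand).
[cite: LandsbergMichalek2018, §3 (inequality (2))] -/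
theorem choose_mul_choose_le_choose (a b c : ℕ) (h : a * b ≤ c) :
    (2 * b + c).choose b * (2 * a + c).choose a ≤ (a * b + 2 * a + 2 * b + c).choose (a * b + a + b) := by
  rcases Nat.eq_zero_or_pos b with rfl | hb
  · simp
  induction a generalizing c with
  | zero => simp
  | succ a ih =>
    have ih' := ih (c + 1) (by nlinarith)
    -- notation
    set N := a + 1 + b + c with hN
    set T := (a + 1) * b + (a + 1) + b with hT
    set T' := a * b + a + b with hT'
    have hTT' : T = T' + (b + 1) := by rw [hT, hT']; ring
    have hNT : T ≤ N := by rw [hT, hN]; nlinarith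
    -- the four binomials
    have hX : (2 * b + c).choose b ≤ (2 * b + (c + 1)).choose b :=
      Nat.choose_le_choose b (by omega)
    have hY : (2 * (a + 1) + c).choose (a + 1) * (a + 1) =
        (2 * a + (c + 1)).choose a * (2 * a + 2 + c) := by
      have := Nat.add_one_mul_choose_eq (2 * a + 1 + c) a
      rw [show 2 * a + 1 + c + 1 = 2 * (a + 1) + c by ring] at this
      rw [show 2 * a + (c + 1) = 2 * a + 1 + c by ring, show 2 * a + 2 + c = 2 * (a + 1) + c by ring,
        mul_comm ((2 * a + 1 + c).choose a), this]
    have hR : (N + T').choose T' * (N + T) ^ (b + 1) ≤ (N + T).choose T * T ^ (b + 1) := by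
      have := choose_mul_pow_le N T' T (b + 1) (by omega)
      rwa [show N + T' + (b + 1) = N + T by omega, show T' + (b + 1) = T by omega] at this
    have hK : (N + (a + 1)) * T ^ (b + 1) ≤ (a + 1) * (N + T) ^ (b + 1) :=
      key_pow_ineq (a + 1) b N (by omega) hb hNT
    have hIH : (2 * b + (c + 1)).choose b * (2 * a + (c + 1)).choose a ≤ (N + T').choose T' := by
      rwa [show N + T' = a * b + 2 * a + 2 * b + (c + 1) by rw [hN, hT']; ring]
    -- the goal, multiplied by `(a+1) T^{b+1} > 0`
    have hgoalN : (a + 1) * b + 2 * (a + 1) + 2 * b + c = N + T := by rw [hN, hT]; ring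
    rw [hgoalN]
    have hpos : 0 < (a + 1) * T ^ (b + 1) := by positivity
    refine Nat.le_of_mul_le_mul_right ?_ hpos
    have h2ac : 2 * a + 2 + c ≤ N + (a + 1) := by rw [hN]; omega
    calc (2 * b + c).choose b * (2 * (a + 1) + c).choose (a + 1) * ((a + 1) * T ^ (b + 1))
        = (2 * b + c).choose b * ((2 * (a + 1) + c).choose (a + 1) * (a + 1)) * T ^ (b + 1) := by ring
      _ = (2 * b + c).choose b * ((2 * a + (c + 1)).choose a * (2 * a + 2 + c)) * T ^ (b + 1) := by
          rw [hY]
      _ ≤ (2 * b + (c + 1)).choose b * ((2 * a + (c + 1)).choose a * (N + (a + 1))) * T ^ (b + 1) := by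
          gcongr
      _ = ((2 * b + (c + 1)).choose b * (2 * a + (c + 1)).choose a) * ((N + (a + 1)) * T ^ (b + 1)) := by
          ring
      _ ≤ (N + T').choose T' * ((a + 1) * (N + T) ^ (b + 1)) := Nat.mul_le_mul hIH hK
      _ = (a + 1) * ((N + T').choose T' * (N + T) ^ (b + 1)) := by ring
      _ ≤ (a + 1) * ((N + T).choose T * T ^ (b + 1)) := Nat.mul_le_mul_left _ hR
      _ = (N + T).choose T * ((a + 1) * T ^ (b + 1)) := by ring

end Binomial


section Young

variable {p : ℕ}

/-- `g(x,y) ≤ g(0, xy + x + y) = C(p + xy + x + y, xy + x + y)` when `xy + x + y ≤ p`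
(the cell inequality in the coordinates of `lmG`). [cite: LandsbergMichalek2018, §3 (inequality (2))] -/
theorem lmCell_choose_le (a : Fin (p + 1) × Fin (p + 1)) {k : ℕ} (hk : (a.1 : ℕ) * a.2 + a.1 + a.2 = k)
    (h : k ≤ p) : (p - a.1 + a.2).choose a.2 * (p + a.1 - a.2).choose a.1 ≤ (p + k).choose k := by
  obtain ⟨c, hc⟩ : ∃ c, p = a.1 + a.2 + c := ⟨p - a.1 - a.2, by omega⟩
  have hab : (a.1 : ℕ) * a.2 ≤ c := by
    generalize hq : (a.1 : ℕ) * a.2 = q at hk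
    omega
  have key := choose_mul_choose_le_choose a.1 a.2 c hab
  have hpk : p + k = a.1 * a.2 + 2 * a.1 + 2 * a.2 + c := by
    generalize hq : (a.1 : ℕ) * a.2 = q at hk ⊢
    omega
  rw [show p - a.1 + a.2 = 2 * a.2 + c by omega, show p + a.1 - a.2 = 2 * a.1 + c by omega, hpk, ← hk]
  exact key

/-- In a Young diagram (lower set) the rectangle below a cell is contained in it:
`(x+1)(y+1) ≤ |λ|` for `(x, y) ∈ λ`. [cite: LandsbergMichalek2018, §3 ("where n > ij")] -/
theorem mul_le_card_of_isLowerSet (D : Finset (Fin (p + 1) × Fin (p + 1)))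
    (hD : IsLowerSet (D : Set (Fin (p + 1) × Fin (p + 1)))) {a : Fin (p + 1) × Fin (p + 1)}
    (ha : a ∈ D) : ((a.1 : ℕ) + 1) * (a.2 + 1) ≤ D.card := by
  have hsub : Finset.Iic a ⊆ D := fun b hb => hD (Finset.mem_Iic.1 hb) ha
  have := Finset.card_le_card hsub
  rwa [Finset.card_Iic_prod, Fin.card_Iic, Fin.card_Iic] at this

/-- Removing a maximal cell from a Young diagram leaves a Young diagram. [folklore] -/
theorem isLowerSet_erase_of_maximal (D : Finset (Fin (p + 1) × Fin (p + 1)))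
    (hD : IsLowerSet (D : Set (Fin (p + 1) × Fin (p + 1)))) {a : Fin (p + 1) × Fin (p + 1)}
    (ha : Maximal (· ∈ D) a) :
    IsLowerSet ((D.erase a : Finset _) : Set (Fin (p + 1) × Fin (p + 1))) := by
  intro b c hcb hb
  rw [Finset.mem_coe, Finset.mem_erase] at hb ⊢
  refine ⟨fun hca => ?_, hD hcb hb.2⟩
  subst hca
  exact hb.1 (le_antisymm (ha.2 hb.2 hcb) hcb)

/-- **The Young diagram maximising `Σ g` is a row** (LM18 §3: "the Young diagram that maximizes
`f_λ` has one row or column"): for a lower set `λ` with `|λ| = m + 1 ≤ p` cells,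
`Σ_{(x,y) ∈ λ} g(x,y) ≤ C(p + m + 1, m)` (`= Σ_{y ≤ m} g(0, y)`). Induction removing a maximal
cell, the cell inequality, monotonicity of `g(0, ·)` and Pascal's rule.
[cite: LandsbergMichalek2018, §3 (f_λ ≤ C(n−1+m, m−1))] -/
theorem sum_lmCell_choose_le (m : ℕ) : ∀ D : Finset (Fin (p + 1) × Fin (p + 1)),
    IsLowerSet (D : Set (Fin (p + 1) × Fin (p + 1))) → D.card = m + 1 → m + 1 ≤ p →
    ∑ a ∈ D, (p - a.1 + a.2).choose a.2 * (p + a.1 - a.2).choose a.1 ≤ (p + m + 1).choose m := by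
  induction m with
  | zero =>
    intro D hD hcard _
    obtain ⟨a, rfl⟩ := Finset.card_eq_one.1 hcard
    have ha : (⊥ : Fin (p + 1) × Fin (p + 1)) ∈ ({a} : Finset _) := hD bot_le (Finset.mem_singleton_self a)
    rw [Finset.mem_singleton] at ha
    rw [Finset.sum_singleton, ← ha]
    simp [bot_eq_zero]
  | succ m ih =>
    intro D hD hcard hmp
    obtain ⟨a, ha⟩ := Finset.exists_maximal (s := D) (Finset.card_pos.1 (by omega))
    have haD : a ∈ D := ha.1
    have hD' := isLowerSet_erase_of_maximal D hD ha
    have hcard' : (D.erase a).card = m + 1 := by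
      rw [Finset.card_erase_of_mem haD, hcard]; rfl
    have ih' := ih (D.erase a) hD' hcard' (by omega)
    rw [← Finset.add_sum_erase D _ haD]
    have hrect := mul_le_card_of_isLowerSet D hD haD
    set k := (a.1 : ℕ) * a.2 + a.1 + a.2 with hk
    have hk1 : ((a.1 : ℕ) + 1) * (a.2 + 1) = k + 1 := by rw [hk]; ring
    rw [hk1, hcard] at hrect
    have hkp : k ≤ p := by omega
    have h1 : (p - a.1 + a.2).choose a.2 * (p + a.1 - a.2).choose a.1 ≤ (p + k).choose k :=
      lmCell_choose_le a hk.symm hkp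
    have h2 : (p + k).choose k ≤ (p + m + 1).choose (m + 1) := by
      calc (p + k).choose k = (p + k).choose p := (Nat.choose_symm_add).symm
        _ ≤ (p + (m + 1)).choose p := Nat.choose_le_choose p (by omega)
        _ = (p + (m + 1)).choose (m + 1) := Nat.choose_symm_add
        _ = (p + m + 1).choose (m + 1) := by rw [← add_assoc]
    have h3 : (p + (m + 1) + 1).choose (m + 1) =
        (p + m + 1).choose m + (p + m + 1).choose (m + 1) := by
      rw [show p + (m + 1) + 1 = (p + m + 1) + 1 by ring, Nat.choose_succ_succ']
    rw [h3]
    omega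

end Young

end Literature.Computability.AlgebraicComplexity
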